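import Literature.Computability.Complexity.BoundedArithmetic
import Literature.Computability.Complexity.BoundedArithmeticMachine
import Literature.Computability.MetaComplexity.BoundedArithS2Nat
import Mathlib.Algebra.Polynomial.Degree.Support
import Mathlib.Algebra.BigOperators.Fin
import HarnessLib

/-!
# Every polynomial-time function is `Σᵇ₁`-definable in `S₂¹` (discharge of
`isSigmabDefinable_S2_one_of_polyTimeComputable`)

Topic `Literature/Computability/Complexity`.  Sibling proof file of `BoundedArithmetic.lean`
(D-0014).  We discharge the named fact

* `isSigmabDefinable_S2_one_of_polyTimeComputable` — **every function `f : ℕ → ℕ` computable in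
  polynomial time (Mathlib's `TM2` model, binary encoding `Computability.encodeNat`) is
  `Σᵇ₁`-definable in `S₂¹`** (Buss 1986, Ch. 3, Main Theorem of that chapter / the "easy
  direction" of Buss's Main Theorem; Krajíček 1995, Lemma 6.1.1 with §5.2–5.4),

semantically for Mathlib's `⊨ᵇ`: the defining formula is the graph of the uniform `Σᵇ₁` definition
`S2Machine.machineG` (`BoundedArithmeticMachine.lean`), which is total and functional in *every*
model of `S₂¹` (`GDef.Good`), and whose value in the standard model `ℕ` is computed here to be
`f` (`S2Machine.fn_machineG`): the blocks of the history are the codes of the configurations of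
the run padded to `|ℓ(x)|` steps (`TM2ArithCode.lean`), and the output block decodes to `f x`.

## References

* S. R. Buss, *Bounded Arithmetic*, Bibliopolis 1986, Ch. 2 (bootstrapping), Ch. 3 (every
  polynomial-time function is `Σᵇ₁`-definable in `S₂¹`).
* J. Krajíček, *Bounded Arithmetic, Propositional Logic and Complexity Theory*, CUP 1995,
  §5.2–5.4, §6.1 (Lemma 6.1.1, p. 86).
-/

namespace Literature.Computability.Complexity

open FirstOrder FirstOrder.Language MetaComplexity MetaComplexity.GDef TM2Arith Turing
  _root_.Computability

namespace S2Machine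

/-! ## The standard model -/

/-- `ℕ ⊨ BASIC` as a local instance. [cite: Buss1986, §2.2] -/
local instance instModelNatBASIC' : ℕ ⊨ BASIC := model_nat_BASIC_holds

/-- `ℕ ⊨ Σᵇ₁-PIND` as a local instance. [cite: Buss1986, §2.4] -/
local instance instModelNatPIND' : ℕ ⊨ PINDScheme (sigmabFormulas 1) := model_nat_PINDScheme _

/-! ## Values of the bounding terms -/

/-- `|2a + 1| = |a| + 1` (Mathlib `Nat.size_bit`). [cite: Buss1986, §2.2 axiom 10] -/
private theorem size_two_mul_succ (a : ℕ) : (2 * a + 1).size = a.size + 1 := by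
  have := Nat.size_bit (b := true) (n := a) (by simp)
  simpa [Nat.bit_val] using this

/-- The length of `smashPow D (x)` is at least `(|x| + 1)^D`. [cite: Buss1986, §2.4] -/
theorem pow_le_size_smashPow (a : ℕ) : ∀ D, (a.size + 1) ^ D ≤ ((smashPow D).realize ![a]).size
  | 0 => by simp [smashPow]
  | D + 1 => by
    have ih := pow_le_size_smashPow a D
    simp only [smashPow, realize_smash, realize_succ, realize_mul, realize_natConst, Term.realize_var,
      Matrix.cons_val_zero, Nat.size_pow, size_two_mul_succ, pow_succ]
    exact Nat.le_succ_of_le (Nat.mul_le_mul_right _ ih)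

/-- A polynomial is dominated by `C·(n+1)^deg`, `C` the sum of its coefficients. [folklore] -/
theorem eval_le_sum_coeff_mul_pow (p : Polynomial ℕ) (n : ℕ) :
    p.eval n ≤ (p.support.sum fun i => p.coeff i) * (n + 1) ^ p.natDegree := by
  rw [Polynomial.eval_eq_sum, Polynomial.sum_def, Finset.sum_mul]
  refine Finset.sum_le_sum fun i hi => Nat.mul_le_mul_left _ ?_
  exact (Nat.pow_le_pow_left (Nat.le_succ n) i).trans
    (Nat.pow_le_pow_right (Nat.succ_pos n) (Polynomial.le_natDegree_of_mem_supp i hi))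

/-- **The time term dominates the polynomial**: `p(|a|) < |timeTerm p (a)|`. [cite: Buss1986, §2.4] -/
theorem eval_lt_size_timeTerm (p : Polynomial ℕ) (a : ℕ) :
    p.eval a.size < ((timeTerm p).realize ![a]).size := by
  have h1 := eval_le_sum_coeff_mul_pow p a.size
  have h2 := pow_le_size_smashPow a p.natDegree
  simp only [timeTerm, realize_smash, realize_natConst, Nat.size_pow]
  set C := p.support.sum fun i => p.coeff i
  calc p.eval a.size ≤ C * (a.size + 1) ^ p.natDegree := h1
    _ ≤ C * ((smashPow p.natDegree).realize ![a]).size := Nat.mul_le_mul_left _ h2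
    _ < (C + 1) * ((smashPow p.natDegree).realize ![a]).size + 1 := by nlinarith

/-! ## The width, block and size parameters in `ℕ` -/

section Params

variable (tm : FinTM2) (ℓ : Language.boundedArith.Term (Fin 1)) (a : ℕ)

/-- The number of simulated steps `L = |ℓ(a)|`. [folklore] -/
noncomputable def nL : ℕ := (ℓ.realize ![a]).size

/-- The field width `W = |ω(a)|`. [folklore] -/
noncomputable def nW : ℕ := ((widthTerm tm ℓ).realize ![a]).size

/-- The block width `B = |β(a)|`. [folklore] -/
noncomputable def nB : ℕ := ((blockTerm tm ℓ).realize ![a]).size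

/-- The size parameter `S = (2ℓ(a)+1) # β(a)`. [folklore] -/
noncomputable def nS : ℕ := (sizeTerm tm ℓ).realize ![a]

variable {tm ℓ a}

/-- The value of `W`. [folklore] -/
theorem nW_eq : nW tm ℓ a = (widthConst tm + 1) * ((a.size + 1) * (nL ℓ a + 1) + 1) + 1 := by
  simp only [nW, nL, widthTerm, realize_smash, realize_natConst, realize_succ, realize_mul,
    Term.realize_var, Matrix.cons_val_zero, Nat.size_pow, size_two_mul_succ]

/-- The value of `B`. [folklore] -/
theorem nB_eq : nB tm ℓ a = (nStk tm + 3) * nW tm ℓ a + 1 := by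
  simp only [nB, nW, blockTerm, realize_smash, realize_natConst, Nat.size_pow]

/-- The value of `|S|`. [folklore] -/
theorem size_nS : (nS tm ℓ a).size = (nL ℓ a + 1) * nB tm ℓ a + 1 := by
  simp only [nS, nL, nB, sizeTerm, sizeT, realize_smash, realize_succ, realize_mul, realize_natConst,
    Nat.size_pow, size_two_mul_succ]

/-- `widthConst · (n+1)(L+1) ≤ W`. [folklore] -/
theorem widthConst_mul_le_nW : widthConst tm * ((a.size + 1) * (nL ℓ a + 1)) ≤ nW tm ℓ a := by
  rw [nW_eq]; nlinarith

/-- `widthConst ≤ W`. [folklore] -/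
theorem widthConst_le_nW : widthConst tm ≤ nW tm ℓ a :=
  le_trans (Nat.le_mul_of_pos_right _ (Nat.mul_pos (Nat.succ_pos _) (Nat.succ_pos _)))
    widthConst_mul_le_nW

/-- The label field fits: `wl ≤ W`. [folklore] -/
theorem labWidth_le_nW : labWidth tm ≤ nW tm ℓ a :=
  le_trans (by unfold widthConst; omega) widthConst_le_nW

/-- The state field fits: `ws ≤ W`. [folklore] -/
theorem stWidth_le_nW : stWidth tm ≤ nW tm ℓ a :=
  le_trans (by unfold widthConst; omega) widthConst_le_nW

/-- `b·(d+1) ≤ W`. [folklore] -/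
theorem symWidth_mul_depth_succ_le_nW : symWidth tm * (TM2Sim.depth tm + 1) ≤ nW tm ℓ a :=
  le_trans (by unfold widthConst; omega) widthConst_le_nW

/-- `b·d ≤ W`. [folklore] -/
theorem symWidth_mul_depth_le_nW : symWidth tm * TM2Sim.depth tm ≤ nW tm ℓ a :=
  le_trans (Nat.mul_le_mul_left _ (Nat.le_succ _)) symWidth_mul_depth_succ_le_nW

/-- `b ≤ W`. [folklore] -/
theorem symWidth_le_nW : symWidth tm ≤ nW tm ℓ a :=
  le_trans (Nat.le_mul_of_pos_right _ (Nat.succ_pos _)) symWidth_mul_depth_succ_le_nW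

/-- **Every stack fits during `L` steps**: `b·(|a| + L·d + d) ≤ W`. [folklore] -/
theorem symWidth_mul_le_nW :
    symWidth tm * (a.size + nL ℓ a * TM2Sim.depth tm + TM2Sim.depth tm) ≤ nW tm ℓ a := by
  have h := widthConst_mul_le_nW (tm := tm) (ℓ := ℓ) (a := a)
  set X := (a.size + 1) * (nL ℓ a + 1) with hX
  have hA : a.size + 1 ≤ X := Nat.le_mul_of_pos_right _ (Nat.succ_pos _)
  have hB : TM2Sim.depth tm * (nL ℓ a + 1) ≤ TM2Sim.depth tm * X :=
    Nat.mul_le_mul_left _ (Nat.le_mul_of_pos_left _ (Nat.succ_pos _))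
  have h2 : a.size + nL ℓ a * TM2Sim.depth tm + TM2Sim.depth tm ≤ (TM2Sim.depth tm + 1) * X := by
    have : a.size + nL ℓ a * TM2Sim.depth tm + TM2Sim.depth tm =
        a.size + TM2Sim.depth tm * (nL ℓ a + 1) := by ring
    rw [this, add_mul, one_mul]
    omega
  have h3 : symWidth tm * (TM2Sim.depth tm + 1) * X ≤ widthConst tm * X :=
    Nat.mul_le_mul_right _ (by unfold widthConst; omega)
  calc symWidth tm * (a.size + nL ℓ a * TM2Sim.depth tm + TM2Sim.depth tm)
      ≤ symWidth tm * ((TM2Sim.depth tm + 1) * X) := Nat.mul_le_mul_left _ h2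
    _ = symWidth tm * (TM2Sim.depth tm + 1) * X := (mul_assoc _ _ _).symm
    _ ≤ nW tm ℓ a := h3.trans h

/-- **A configuration code fits in a block**: `(nStk + 2)·W ≤ B`. [folklore] -/
theorem nStk_mul_nW_le_nB : (nStk tm + 2) * nW tm ℓ a ≤ nB tm ℓ a := by rw [nB_eq]; nlinarith

/-- `B ≤ |S|`. [folklore] -/
theorem nB_le_size_nS : nB tm ℓ a ≤ (nS tm ℓ a).size := by rw [size_nS]; nlinarith

/-- `(L+1)·B ≤ |S|`. [folklore] -/
theorem succ_nL_mul_nB_le_size_nS : (nL ℓ a + 1) * nB tm ℓ a ≤ (nS tm ℓ a).size := by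
  rw [size_nS]; exact Nat.le_succ _

/-- Offsets of the fields of a code are below `|S|`: `i·W ≤ |S|` for `i ≤ nStk + 2`. [folklore] -/
theorem mul_nW_le_size_nS {i : ℕ} (hi : i ≤ nStk tm + 2) : i * nW tm ℓ a ≤ (nS tm ℓ a).size :=
  ((Nat.mul_le_mul_right _ hi).trans nStk_mul_nW_le_nB).trans nB_le_size_nS

/-- `W ≤ |S|`. [folklore] -/
theorem nW_le_size_nS : nW tm ℓ a ≤ (nS tm ℓ a).size := by
  simpa using mul_nW_le_size_nS (tm := tm) (ℓ := ℓ) (a := a) (i := 1) (by omega)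

end Params

/-! ## Digit codes as sums -/

/-- `dcode w (ofFn g) = Σᵢ g i · 2^(w·i)`. [folklore] -/
theorem dcode_ofFn (w : ℕ) : ∀ {n : ℕ} (g : Fin n → ℕ), dcode w (List.ofFn g) = ∑ i, g i * 2 ^ (w * i)
  | 0, g => by simp
  | n + 1, g => by
    rw [List.ofFn_succ, dcode_cons, dcode_ofFn w, Fin.sum_univ_succ]
    simp only [Fin.val_zero, mul_zero, pow_zero, mul_one, Fin.val_succ, Finset.mul_sum]
    congr 1
    refine Finset.sum_congr rfl fun i _ => ?_
    rw [Nat.mul_succ, pow_add]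
    ring

/-- The sum form of a list `[x, y] ++ ofFn g` in base `2ʷ`. [folklore] -/
theorem dcode_pair_append_ofFn (w x y : ℕ) {n : ℕ} (g : Fin n → ℕ) :
    dcode w ([x, y] ++ List.ofFn g) = x + y * 2 ^ w + ∑ i, g i * 2 ^ (w * (i + 2)) := by
  rw [dcode_append, dcode_ofFn]
  simp only [List.length_cons, List.length_nil, dcode_cons, dcode_nil, mul_zero, add_zero, Finset.mul_sum,
    zero_add, one_add_one_eq_two]
  rw [mul_comm (2 ^ w) y]
  congr 1
  refine Finset.sum_congr rfl fun i _ => ?_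
  rw [Nat.mul_add, pow_add]
  ring

/-! ## Values in `ℕ` of the step definitions -/

section StepValues

variable {tm : FinTM2} {ℓ : Language.boundedArith.Term (Fin 1)} {a : ℕ}

/-- `Fin.snoc` twice on a singleton is a triple (private vector bookkeeping; cf. `PVFun.snoc_vec*` in
`PVPrograms.lean`, not importable here). [folklore] -/
private theorem snoc_snoc_vec (a j c : ℕ) : (Fin.snoc (Fin.snoc ![a] j) c : Fin 3 → ℕ) = ![a, j, c] := by
  funext i; fin_cases i <;> rfl

/-- `Fin.snoc` on a singleton is a pair. [folklore] -/
private theorem snoc_vec (a i : ℕ) : (Fin.snoc ![a] i : Fin 2 → ℕ) = ![a, i] := by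
  funext k; fin_cases k <;> rfl

/-- `Fin.snoc` on a triple. [folklore] -/
private theorem snoc_vec3 (a j c y : ℕ) : (Fin.snoc ![a, j, c] y : Fin 4 → ℕ) = ![a, j, c, y] := by
  funext k; fin_cases k <;> rfl

/-- `Fin.snoc` on a pair. [folklore] -/
private theorem snoc_vec2 (a c y : ℕ) : (Fin.snoc ![a, c] y : Fin 3 → ℕ) = ![a, c, y] := by
  funext k; fin_cases k <;> rfl

/-- Restricting a triple to its first coordinate. [folklore] -/
private theorem vec3_comp_zero (a j c : ℕ) : (![a, j, c] : Fin 3 → ℕ) ∘ ![(0 : Fin 3)] = ![a] := by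
  funext k; fin_cases k; rfl

/-- Restricting a pair to its first coordinate. [folklore] -/
private theorem vec2_comp_zero (a c : ℕ) : (![a, c] : Fin 2 → ℕ) ∘ ![(0 : Fin 2)] = ![a] := by
  funext k; fin_cases k; rfl

/-- The value of the numeral definition in `ℕ`. [folklore] -/
theorem fn_num_nat {n : ℕ} (k : ℕ) (x : Fin n → ℕ) : (num n k).fn x = k := by
  rw [num, fn_ofTerm, realize_natConst]

/-- Bridge: the addition of the `BASICModel` instances on `ℕ` is `Nat.add`. [folklore] -/
theorem hAdd_model (u v : ℕ) : @HAdd.hAdd ℕ ℕ ℕ (@instHAdd ℕ (BASICModel.instAdd (M := ℕ))) u v = u + v :=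
  rfl

/-- Bridge: the multiplication of the `BASICModel` instances on `ℕ` is `Nat.mul`. [folklore] -/
theorem hMul_model (u v : ℕ) : @HMul.hMul ℕ ℕ ℕ (@instHMul ℕ (BASICModel.instMul (M := ℕ))) u v = u * v :=
  rfl

/-- `List.sum_ofFn` at `ℕ` (stated separately to fix the carrier for `simp`). [folklore] -/
theorem sum_ofFn_nat {n : ℕ} (f : Fin n → ℕ) : (List.ofFn f).sum = ∑ i, f i := List.sum_ofFn

/-- Bridge: `List.sum` for the `BASICModel` instances on `ℕ` is the ordinary sum. [folklore] -/
theorem sum_model (l : List ℕ) :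
    @List.sum ℕ (BASICModel.instAdd (M := ℕ)) (BASICModel.instZero (M := ℕ)) l = l.sum := by
  induction l with
  | nil => rfl
  | cons u l ih => rw [List.sum_cons, List.sum_cons, ← ih]; rfl

/-- The size parameter in the context `(x, j, c)`. [folklore] -/
theorem realize_S3 (j c : ℕ) : (S3 tm ℓ).realize ![a, j, c] = nS tm ℓ a := by
  rw [S3, Term.realize_relabel, vec3_comp_zero]; rfl

/-- The field width in the context `(x, j, c)`. [folklore] -/
theorem realize_W3 (j c : ℕ) : (W3 tm ℓ).realize ![a, j, c] = nW tm ℓ a := by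
  rw [W3, realize_len, Term.realize_relabel, vec3_comp_zero]; rfl

/-- **`fieldG` extracts field `i`** (`i ≤ nStk + 2`). [folklore] -/
theorem fn_fieldG {i : ℕ} (hi : i ≤ nStk tm + 2) (j c : ℕ) :
    (fieldG tm ℓ i).fn ![a, j, c] = field (nW tm ℓ a) c i := by
  rw [fieldG, fn_substArgs good_blkG, fn_blkG]
  simp only [Matrix.cons_val_zero, Matrix.cons_val_one, Matrix.cons_val, realize_S3, realize_W3,
    Term.realize_var, realize_natConst]
  rw [NatModel.blk_eq, min_eq_left (mul_nW_le_size_nS hi), min_eq_left nW_le_size_nS, field, Nat.mul_comm]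

/-- The value of `lspConstG` (`m ≤ W`). [folklore] -/
theorem fn_lspConstG {F : GDef 3} (hF : F.Good) {m : ℕ} (hm : m ≤ nW tm ℓ a) (j c : ℕ) :
    (lspConstG tm ℓ F m).fn ![a, j, c] = F.fn ![a, j, c] % 2 ^ m := by
  rw [lspConstG, fn_substLast (good_lspG.substArgs _) hF, fn_substArgs good_lspG, fn_lspG, snoc_vec3]
  simp only [Matrix.cons_val_zero, Matrix.cons_val_one, Matrix.cons_val, Term.realize_var, realize_natConst,
    Term.realize_relabel]
  have hcs : (![a, j, c, F.fn ![a, j, c] ] : Fin 4 → ℕ) ∘ Fin.castSucc = ![a, j, c] := by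
    funext k; fin_cases k <;> rfl
  rw [hcs, realize_S3, NatModel.lsp_eq, min_eq_left (hm.trans nW_le_size_nS)]

/-- The value of `mspConstG` (`m ≤ W`). [folklore] -/
theorem fn_mspConstG {F : GDef 3} (hF : F.Good) {m : ℕ} (hm : m ≤ nW tm ℓ a) (j c : ℕ) :
    (mspConstG tm ℓ F m).fn ![a, j, c] = F.fn ![a, j, c] / 2 ^ m := by
  rw [mspConstG, fn_substLast (good_mspG.substArgs _) hF, fn_substArgs good_mspG, fn_mspG, snoc_vec3]
  simp only [Matrix.cons_val_zero, Matrix.cons_val_one, Matrix.cons_val, Term.realize_var, realize_natConst,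
    Term.realize_relabel]
  have hcs : (![a, j, c, F.fn ![a, j, c] ] : Fin 4 → ℕ) ∘ Fin.castSucc = ![a, j, c] := by
    funext k; fin_cases k <;> rfl
  rw [hcs, realize_S3, NatModel.msp_eq, min_eq_left (hm.trans nW_le_size_nS)]

/-- The value of `lspWG`: reduction modulo `2ᵂ`. [folklore] -/
theorem fn_lspWG {F : GDef 3} (hF : F.Good) (j c : ℕ) :
    (lspWG tm ℓ F).fn ![a, j, c] = F.fn ![a, j, c] % 2 ^ nW tm ℓ a := by
  rw [lspWG, fn_substLast (good_lspG.substArgs _) hF, fn_substArgs good_lspG, fn_lspG, snoc_vec3]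
  simp only [Matrix.cons_val_zero, Matrix.cons_val_one, Matrix.cons_val, Term.realize_var,
    Term.realize_relabel]
  have hcs : (![a, j, c, F.fn ![a, j, c] ] : Fin 4 → ℕ) ∘ Fin.castSucc = ![a, j, c] := by
    funext k; fin_cases k <;> rfl
  rw [hcs, realize_S3, realize_W3, NatModel.lsp_eq, min_eq_left nW_le_size_nS]

/-- The value of `pwWG i` (`i ≤ nStk + 2`): `2^(i·W)`. [folklore] -/
theorem fn_pwWG {i : ℕ} (hi : i ≤ nStk tm + 2) (j c : ℕ) :
    (pwWG tm ℓ i).fn ![a, j, c] = 2 ^ (nW tm ℓ a * i) := by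
  rw [pwWG, fn_substArgs good_pwG, fn_pwG]
  simp only [Matrix.cons_val_zero, Matrix.cons_val_one, realize_S3, realize_mul, realize_natConst, realize_W3]
  rw [NatModel.pw_eq, min_eq_left (mul_nW_le_size_nS hi), Nat.mul_comm]

/-- The value of `topG i`: `field (i+2) mod 2^(b·d)`. [folklore] -/
theorem fn_topG (i : Fin (nStk tm)) (j c : ℕ) :
    (topG tm ℓ i).fn ![a, j, c] = field (nW tm ℓ a) c (i + 2) % 2 ^ (symWidth tm * TM2Sim.depth tm) := by
  rw [topG, fn_lspConstG (good_fieldG _) symWidth_mul_depth_le_nW, fn_fieldG (i := i + 2) (by omega)]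

/-- **`keyG` reads the key off the code.** [folklore] -/
theorem fn_keyG (j c : ℕ) : (keyG tm ℓ).fn ![a, j, c] = codeKey tm (nW tm ℓ a) c := by
  rw [keyG, fn_addG (good_fieldG 0) ((good_num _ _).mulG ((good_fieldG 1).addG ((good_num _ _).mulG
      (good_sumG fun F hF => by
        obtain ⟨i, rfl⟩ := (List.mem_ofFn' _ _).1 hF; exact (good_topG i).mulG (good_num _ _))))),
    fn_mulG (good_num _ _) ((good_fieldG 1).addG ((good_num _ _).mulG
      (good_sumG fun F hF => by
        obtain ⟨i, rfl⟩ := (List.mem_ofFn' _ _).1 hF; exact (good_topG i).mulG (good_num _ _)))),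
    fn_addG (good_fieldG 1) ((good_num _ _).mulG
      (good_sumG fun F hF => by
        obtain ⟨i, rfl⟩ := (List.mem_ofFn' _ _).1 hF; exact (good_topG i).mulG (good_num _ _))),
    fn_mulG (good_num _ _) (good_sumG fun F hF => by
        obtain ⟨i, rfl⟩ := (List.mem_ofFn' _ _).1 hF; exact (good_topG i).mulG (good_num _ _)),
    fn_sumG fun F hF => by
        obtain ⟨i, rfl⟩ := (List.mem_ofFn' _ _).1 hF; exact (good_topG i).mulG (good_num _ _)]
  rw [fn_fieldG (i := 0) (by omega), fn_fieldG (i := 1) (by omega), fn_num_nat, fn_num_nat, List.map_ofFn]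
  have hterm : ∀ i : Fin (nStk tm),
      ((topG tm ℓ i).mulG (num 3 (2 ^ (symWidth tm * TM2Sim.depth tm * i)))).fn ![a, j, c] =
        field (nW tm ℓ a) c (i + 2) % 2 ^ (symWidth tm * TM2Sim.depth tm) *
          2 ^ (symWidth tm * TM2Sim.depth tm * i) := fun i => by
    rw [fn_mulG (good_topG i) (good_num _ _), fn_topG, fn_num_nat, hMul_model]
  simp only [hAdd_model, hMul_model, sum_model, sum_ofFn_nat, Function.comp_apply, hterm]
  rw [codeKey, dcode_ofFn]

/-- The value of `newStkG κ i`. [folklore] -/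
theorem fn_newStkG (κ : ℕ) (i : Fin (nStk tm)) (j c : ℕ) :
    (newStkG tm ℓ κ i).fn ![a, j, c] =
      (respSeg tm κ i + 2 ^ (symWidth tm * respLen tm κ i) *
        (field (nW tm ℓ a) c (i + 2) / 2 ^ (symWidth tm * TM2Sim.depth tm))) % 2 ^ nW tm ℓ a := by
  rw [newStkG, fn_lspWG ((good_num _ _).addG ((good_num _ _).mulG (good_mspConstG (good_fieldG _) _))),
    fn_addG (good_num _ _) ((good_num _ _).mulG (good_mspConstG (good_fieldG _) _)),
    fn_mulG (good_num _ _) (good_mspConstG (good_fieldG _) _), fn_num_nat, fn_num_nat,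
    fn_mspConstG (good_fieldG _) symWidth_mul_depth_le_nW, fn_fieldG (i := i + 2) (by omega)]
  rfl

/-- **The value of `applyG κ`**: the spliced code for the response of key `κ`. [folklore] -/
theorem fn_applyG (κ : ℕ) (j c : ℕ) :
    (applyG tm ℓ κ).fn ![a, j, c] =
      dcode (nW tm ℓ a) ([respLab tm κ, respSt tm κ] ++ List.ofFn fun i : Fin (nStk tm) =>
        (respSeg tm κ i + 2 ^ (symWidth tm * respLen tm κ i) *
          (field (nW tm ℓ a) c (i + 2) / 2 ^ (symWidth tm * TM2Sim.depth tm))) % 2 ^ nW tm ℓ a) := by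
  have hgood : ∀ F ∈ ([num 3 (respLab tm κ), mulG (num 3 (respSt tm κ)) (pwWG tm ℓ 1)] ++
      List.ofFn fun i : Fin (nStk tm) => mulG (newStkG tm ℓ κ i) (pwWG tm ℓ (i + 2))), F.Good := by
    intro F hF
    simp only [List.cons_append, List.nil_append, List.mem_cons, List.mem_ofFn] at hF
    rcases hF with rfl | rfl | ⟨i, rfl⟩
    · exact good_num _ _
    · exact (good_num _ _).mulG (good_pwWG _)
    · exact (good_newStkG κ i).mulG (good_pwWG _)
  have h1 : ((num 3 (respSt tm κ)).mulG (pwWG tm ℓ 1)).fn ![a, j, c] = respSt tm κ * 2 ^ nW tm ℓ a := by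
    rw [fn_mulG (good_num _ _) (good_pwWG _), fn_num_nat, fn_pwWG (i := 1) (by omega), hMul_model, Nat.mul_one]
  have hterm : ∀ i : Fin (nStk tm), ((newStkG tm ℓ κ i).mulG (pwWG tm ℓ (i + 2))).fn ![a, j, c] =
      (respSeg tm κ i + 2 ^ (symWidth tm * respLen tm κ i) *
          (field (nW tm ℓ a) c (i + 2) / 2 ^ (symWidth tm * TM2Sim.depth tm))) % 2 ^ nW tm ℓ a *
        2 ^ (nW tm ℓ a * (i + 2)) := fun i => by
    rw [fn_mulG (good_newStkG κ i) (good_pwWG _), fn_newStkG, fn_pwWG (i := i + 2) (by omega), hMul_model]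
  rw [applyG, fn_sumG hgood, dcode_pair_append_ofFn]
  simp only [List.cons_append, List.nil_append, List.map_cons, List.map_ofFn, List.sum_cons, sum_model,
    hAdd_model, sum_ofFn_nat, Function.comp_apply, h1, hterm, fn_num_nat, add_assoc]

/-- **The step definition computes the arithmetic step on configuration codes**: for a good
configuration fitting in width `W`, `stepG (x, j, ⌜c⌝) = ⌜stepTotal c⌝`
(Krajíček 1995, §6.1). [cite: Krajicek1995, Lemma 6.1.1 (p. 86)] -/
theorem fn_stepG_cfgCode {c : (tm).Cfg} (hfit : Fits (nW tm ℓ a) c) (hc : TM2Sim.Good tm c) (j : ℕ) :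
    (stepG tm ℓ).fn ![a, j, cfgCode tm (nW tm ℓ a) c] = cfgCode tm (nW tm ℓ a) (TM2Sim.stepTotal tm c) := by
  set κ := codeKey tm (nW tm ℓ a) (cfgCode tm (nW tm ℓ a) c) with hκ
  have hκlt : κ < 2 ^ keyWidth tm := by
    rw [hκ, codeKey_cfgCode hfit]; exact viewKey_lt (good_view hc)
  have hmem : (κ, applyG tm ℓ κ) ∈ (List.range (2 ^ keyWidth tm)).map fun κ => (κ, applyG tm ℓ κ) :=
    List.mem_map.2 ⟨κ, List.mem_range.2 hκlt, rfl⟩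
  rw [stepG, fn_select_of_mem good_keyG (fun p hp => by
      obtain ⟨κ', -, rfl⟩ := List.mem_map.1 hp; exact good_applyG κ') (good_num _ _)
      (by rw [List.map_map]; simpa [Function.comp_def] using List.nodup_range) _ hmem
      (by rw [fn_keyG, ← hκ]; exact (fn_num_nat κ _).symm.trans (fn_num κ ![a, j, cfgCode tm (nW tm ℓ a) c]))]
  change (applyG tm ℓ κ).fn _ = _
  rw [fn_applyG, ← stepCode_cfgCode hfit hc, stepCode, hκ]
  rfl

end StepValues

/-! ## Uniqueness of base-`2ᵇ` digit expansions -/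

/-- Two numbers below `2^(b·n)` with the same `n` low digits in base `2ᵇ` are equal. [folklore] -/
theorem eq_of_digits_eq (b : ℕ) : ∀ (n : ℕ) {x y : ℕ}, x < 2 ^ (b * n) → y < 2 ^ (b * n) →
    (∀ i < n, x / 2 ^ (b * i) % 2 ^ b = y / 2 ^ (b * i) % 2 ^ b) → x = y
  | 0, x, y, hx, hy, _ => by simp at hx hy; omega
  | n + 1, x, y, hx, hy, h => by
    have h0 := h 0 (Nat.succ_pos n)
    simp only [mul_zero, pow_zero, Nat.div_one] at h0
    have hx' : x / 2 ^ b < 2 ^ (b * n) :=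
      Nat.div_lt_of_lt_mul (by rw [← pow_add]; convert hx using 2; ring)
    have hy' : y / 2 ^ b < 2 ^ (b * n) :=
      Nat.div_lt_of_lt_mul (by rw [← pow_add]; convert hy using 2; ring)
    have ih := eq_of_digits_eq b n hx' hy' fun i hi => by
      have := h (i + 1) (Nat.succ_lt_succ hi)
      rwa [Nat.mul_succ, pow_add, mul_comm (2 ^ (b * i)), ← Nat.div_div_eq_div_mul,
        ← Nat.div_div_eq_div_mul] at this
    rw [← Nat.div_add_mod x (2 ^ b), ← Nat.div_add_mod y (2 ^ b), ih, h0]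

/-- A number below `2^(b·n)` is the code of its `n` digits. [folklore] -/
theorem eq_dcode_ofFn {b n x : ℕ} (hx : x < 2 ^ (b * n)) {d : Fin n → ℕ} (hd : ∀ i, d i < 2 ^ b)
    (h : ∀ i : Fin n, x / 2 ^ (b * i) % 2 ^ b = d i) : x = dcode b (List.ofFn d) := by
  have hL : ∀ y ∈ List.ofFn d, y < 2 ^ b := fun y hy => by
    obtain ⟨i, rfl⟩ := (List.mem_ofFn' _ _).1 hy; exact hd i
  refine eq_of_digits_eq b n hx (by simpa using dcode_lt hL) fun i hi => ?_
  rw [dcode_digit hL, h ⟨i, hi⟩, List.getD_eq_getElem?_getD, List.getElem?_ofFn]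
  simp [hi]

/-! ## `encodeNat` and bits -/

/-- `encodePosNum p` is the list of binary digits of `p`, least significant first. [folklore] -/
private theorem encodePosNum_eq_bits : ∀ p : PosNum, encodePosNum p = (p : ℕ).bits
  | PosNum.one => by simp [encodePosNum, Nat.one_bits]
  | PosNum.bit0 p => by
    rw [encodePosNum, encodePosNum_eq_bits p, PosNum.cast_bit0, ← two_mul, Nat.bit0_bits]
    exact (PosNum.cast_pos p).ne'
  | PosNum.bit1 p => by
    rw [encodePosNum, encodePosNum_eq_bits p, PosNum.cast_bit1, ← two_mul, Nat.bit1_bits]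

/-- `encodeNat n` is the list of binary digits of `n` (`Nat.bits`; a private copy of
`Cryptography.encodeNat_eq_bits`, not importable here). [folklore] -/
private theorem encodeNat_eq_bits (n : ℕ) : encodeNat n = n.bits := by
  rw [encodeNat]
  cases h : (n : Num) with
  | zero =>
    have hn : n = 0 := by rw [← Num.to_of_nat n, h]; rfl
    subst hn
    rfl
  | pos p =>
    have hn : n = (p : ℕ) := by rw [← Num.to_of_nat n, h, Num.cast_pos]
    rw [encodeNum, encodePosNum_eq_bits, ← hn]

/-- `|encodeNat n| = Nat.size n`. [folklore] -/
private theorem length_encodeNat' (n : ℕ) : (encodeNat n).length = n.size := by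
  rw [encodeNat_eq_bits, Nat.size_eq_bits_len]

/-- The entries of `encodeNat n` are the bits `Nat.testBit n i`. [folklore] -/
private theorem getD_encodeNat' (n i : ℕ) : (encodeNat n).getD i false = n.testBit i := by
  rw [encodeNat_eq_bits, Nat.testBit_eq_inth, List.getI_eq_getElem?_getD, List.getD_eq_getElem?_getD]
  rfl

/-- `true ∉ encodeNat n` forces `n = 0`. [folklore] -/
private theorem eq_zero_of_true_not_mem_encodeNat {n : ℕ} (h : true ∉ encodeNat n) : n = 0 := by
  refine Nat.eq_of_testBit_eq fun i => ?_
  rw [Nat.zero_testBit, ← getD_encodeNat', List.getD_eq_getElem?_getD]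
  cases hi : (encodeNat n)[i]? with
  | none => rfl
  | some b =>
    cases b with
    | false => rfl
    | true => exact absurd (List.mem_of_getElem? hi) h

/-- The input word as a digit list: `(encodeNat a).map g = ofFn (i ↦ g (testBit a i))`. [folklore] -/
theorem map_encodeNat_eq_ofFn {α : Type} (g : Bool → α) (a : ℕ) :
    (encodeNat a).map g = List.ofFn fun i : Fin a.size => g (a.testBit i) := by
  refine List.ext_getElem (by simp [length_encodeNat']) fun i h1 h2 => ?_
  simp only [List.getElem_map, List.getElem_ofFn]
  congr 1
  rw [← getD_encodeNat', List.getD_eq_getElem?_getD, List.getElem?_eq_getElem (by simpa using h1)]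
  rfl

/-! ## Values in `ℕ` of the initial-configuration definitions -/

section InitValues

variable {tm : FinTM2} {ℓ : Language.boundedArith.Term (Fin 1)} {a : ℕ} {cfalse ctrue : ℕ}

/-- The digit width is positive as soon as the input alphabet is inhabited. [folklore] -/
theorem one_le_symWidth (γ : tm.Γ tm.k₀) : 1 ≤ symWidth tm := by
  have h1 := symCode_pos (tm := tm) (k := tm.k₀) (γ := γ) (Or.inr rfl)
  have h2 := symCode_lt (tm := tm) tm.k₀ γ
  by_contra h
  rw [not_le, Nat.lt_one_iff] at h
  rw [h, pow_zero] at h2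
  omega

/-- `|inBeta| = b`. [folklore] -/
theorem size_inBeta (v : Fin 1 → ℕ) : ((inBeta tm).realize v).size = symWidth tm := by
  rw [inBeta, realize_natConst]
  rcases Nat.eq_zero_or_pos (symWidth tm) with h | h
  · rw [h]; rfl
  · obtain ⟨k, hk⟩ := Nat.exists_eq_add_of_le' h
    rw [hk, pow_succ, Nat.mul_div_cancel _ two_pos, Nat.size_pow]

/-- The size parameter of the input comprehension. [folklore] -/
theorem size_sizeT_inBeta : ((sizeT (Term.var 0) (inBeta tm)).realize ![a]).size =
    (a.size + 1) * symWidth tm + 1 := by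
  simp only [sizeT, realize_smash, realize_succ, realize_mul, realize_natConst, Term.realize_var,
    Matrix.cons_val_zero, Nat.size_pow, size_two_mul_succ, size_inBeta]

/-- **`bitG` reads bit `i`** of `a` (`i ≤ |a|`, `b ≥ 1`). [cite: Buss1986, §2.5] -/
theorem fn_bitG (hb : 1 ≤ symWidth tm) {i : ℕ} (hi : i ≤ a.size) :
    (bitG tm).fn ![a, i] = (a.testBit i).toNat := by
  rw [bitG, fn_substLast (good_parityG.substArgs _) (good_mspG.substArgs _), fn_substArgs good_parityG,
    fn_parityG, fn_substArgs good_mspG, fn_mspG, snoc_vec2]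
  simp only [Matrix.cons_val_zero, Matrix.cons_val_one, Matrix.cons_val, Term.realize_var, Term.realize_relabel,
    vec2_comp_zero]
  change BASICModel.bit _ a i = _
  refine NatModel.bit_eq_testBit (hi.trans ?_)
  rw [size_sizeT_inBeta]
  nlinarith

/-- **The input digit** `i` (`i ≤ |a|`): the code of the symbol carrying bit `i`. [folklore] -/
theorem fn_inDigitG (hb : 1 ≤ symWidth tm) {i : ℕ} (hi : i ≤ a.size) :
    (inDigitG tm cfalse ctrue).fn ![a, i] = if a.testBit i then ctrue else cfalse := by
  have hc : ∀ p ∈ [((0 : ℕ), num 2 cfalse), (1, num 2 ctrue)], p.2.Good := by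
    intro p hp
    simp only [List.mem_cons, List.not_mem_nil, or_false] at hp
    rcases hp with rfl | rfl <;> exact good_num _ _
  unfold inDigitG
  cases hbit : a.testBit i
  · rw [fn_select_of_mem good_bitG hc (good_num _ _) (by simp) _ (p := (0, num 2 cfalse)) (by simp)
        (by rw [fn_bitG hb hi, hbit]; exact (fn_num_nat 0 _).symm.trans (fn_num 0 ![a, i]))]
    exact fn_num_nat _ _
  · rw [fn_select_of_mem good_bitG hc (good_num _ _) (by simp) _ (p := (1, num 2 ctrue)) (by simp)
        (by rw [fn_bitG hb hi, hbit]; exact (fn_num_nat 1 _).symm.trans (fn_num 1 ![a, i]))]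
    exact fn_num_nat _ _

/-- **The input stack code**: the digits of `inputStackG (a)` in base `2ᵇ` are the input digits,
so it is `dcode b` of them (`cfalse, ctrue < 2ᵇ`). [cite: Krajicek1995, §6.1 (p. 86)] -/
theorem fn_inputStackG (hb : 1 ≤ symWidth tm) (hcf : cfalse < 2 ^ symWidth tm) (hct : ctrue < 2 ^ symWidth tm) :
    (inputStackG tm cfalse ctrue).fn ![a] =
      dcode (symWidth tm) (List.ofFn fun i : Fin a.size => if a.testBit i then ctrue else cfalse) := by
  set w := (inputStackG tm cfalse ctrue).fn ![a] with hw
  have hS : (seqS (Term.var 0) (inBeta tm) ![a]).size = (a.size + 1) * symWidth tm + 1 := size_sizeT_inBeta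
  have hB : seqB (inBeta tm) ![a] = symWidth tm := size_inBeta _
  have hn : mLen ((Term.var (0 : Fin 1) : Language.boundedArith.Term (Fin 1)).realize ![a]) = a.size := rfl
  -- `w < 2^(n·b)`
  have h1 := msp_collect (ℓ := Term.var 0) (β := inBeta tm) (good_inDigitG (tm := tm) (cfalse := cfalse)
    (ctrue := ctrue)) ![a]
  rw [hn, hB, NatModel.msp_eq, hS, min_eq_left (by rw [add_mul, one_mul]; omega)] at h1
  change w / 2 ^ (a.size * symWidth tm) = 0 at h1
  have hwlt : w < 2 ^ (symWidth tm * a.size) := by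
    rw [Nat.mul_comm]; exact Nat.lt_of_div_eq_zero (Nat.two_pow_pos _) h1
  refine eq_dcode_ofFn hwlt (fun i => by split_ifs <;> assumption) fun i => ?_
  have h2 := blk_collect (ℓ := Term.var 0) (β := inBeta tm) (good_inDigitG (tm := tm) (cfalse := cfalse)
    (ctrue := ctrue)) ![a] (i := (i : ℕ)) ((NatModel.lt_model_iff _ _).2 (by rw [hn]; exact i.isLt))
  rw [hB, NatModel.blk_eq, NatModel.lsp_eq, hS,
    min_eq_left ((Nat.mul_le_mul_right _ (by omega : (i : ℕ) ≤ a.size + 1)).trans (Nat.le_succ _)),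
    min_eq_left ((Nat.le_mul_of_pos_left _ (Nat.succ_pos _)).trans (Nat.le_succ _)),
    snoc_vec, fn_inDigitG hb i.isLt.le] at h2
  change w / 2 ^ ((i : ℕ) * symWidth tm) % 2 ^ symWidth tm = _ at h2
  rw [Nat.mul_comm] at h2
  rw [h2]
  exact Nat.mod_eq_of_lt (by split_ifs <;> assumption)

/-- **The code of the input stack** of the initial configuration on input `a`. [folklore] -/
theorem stkCode_input (ein : tm.Γ tm.k₀ ≃ Bool) :
    stkCode tm ((encodeNat a).map ein.symm) = dcode (symWidth tm) (List.ofFn fun i : Fin a.size =>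
      if a.testBit i then symCode tm tm.k₀ (ein.symm true) else symCode tm tm.k₀ (ein.symm false)) := by
  rw [stkCode, List.map_map, map_encodeNat_eq_ofFn]
  congr 1
  refine List.ofFn_inj.2 (funext fun i => ?_)
  cases a.testBit i <;> rfl

/-- The value of `pwW1 i` (`i ≤ nStk + 2`): `2^(W·i)`. [folklore] -/
theorem fn_pwW1 {i : ℕ} (hi : i ≤ nStk tm + 2) : (pwW1 tm ℓ i).fn ![a] = 2 ^ (nW tm ℓ a * i) := by
  rw [pwW1, fn_substArgs good_pwG, fn_pwG]
  simp only [Matrix.cons_val_zero, Matrix.cons_val_one, realize_mul, realize_natConst, realize_len]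
  change BASICModel.pw (nS tm ℓ a) (i * nW tm ℓ a) = _
  rw [NatModel.pw_eq, min_eq_left (mul_nW_le_size_nS hi), Nat.mul_comm]

/-- **The value of `initG`**. [folklore] -/
theorem fn_initG {lab0 st0 kin : ℕ} (hkin : kin < nStk tm) :
    (initG tm ℓ cfalse ctrue lab0 st0 kin).fn ![a] =
      lab0 + st0 * 2 ^ nW tm ℓ a + (inputStackG tm cfalse ctrue).fn ![a] * 2 ^ (nW tm ℓ a * (kin + 2)) := by
  have hgood : ∀ F ∈ [num 1 lab0, mulG (num 1 st0) (pwW1 tm ℓ 1),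
      mulG (inputStackG tm cfalse ctrue) (pwW1 tm ℓ (kin + 2))], F.Good := by
    intro F hF
    simp only [List.mem_cons, List.not_mem_nil, or_false] at hF
    rcases hF with rfl | rfl | rfl
    · exact good_num _ _
    · exact (good_num _ _).mulG (good_pwW1 _)
    · exact good_inputStackG.mulG (good_pwW1 _)
  rw [initG, fn_sumG hgood]
  simp only [List.map_cons, List.map_nil, sum_model]
  simp only [List.sum_cons, List.sum_nil, add_zero]
  rw [fn_num_nat, fn_mulG (good_num _ _) (good_pwW1 _), fn_num_nat, fn_pwW1 (i := 1) (by omega),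
    fn_mulG good_inputStackG (good_pwW1 _), fn_pwW1 (i := kin + 2) (by omega), hMul_model, hMul_model,
    Nat.mul_one, add_assoc]

/-- **The code of an initial configuration**: label, state and the input stack at the index of
`k₀`. [folklore] -/
theorem cfgCode_initList (W : ℕ) (input : List (tm.Γ tm.k₀)) :
    cfgCode tm W (initList tm input) = labCode tm (some tm.main) + stCode tm tm.initialState * 2 ^ W +
      stkCode tm input * 2 ^ (W * (idxOf tm tm.k₀ + 2)) := by
  rw [cfgCode, fields, TM2Comp.initList_eq, dcode_pair_append_ofFn]
  congr 1
  rw [Finset.sum_eq_single (idxOf tm tm.k₀)]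
  · dsimp only
    rw [stkOf_idxOf, Function.update_self]
  · intro i _ hi
    have hne : stkOf tm i ≠ tm.k₀ := fun h => hi (by rw [← idxOf_stkOf i, h])
    dsimp only
    rw [Function.update_of_ne hne]
    simp [stkCode]
  · intro h; exact absurd (Finset.mem_univ _) h

end InitValues

/-! ## The blocks of the history are the configuration codes of the padded run -/

section Run

variable {tm : FinTM2} {ℓ : Language.boundedArith.Term (Fin 1)} {a : ℕ} {cfalse ctrue lab0 st0 kin : ℕ}

/-- A fitting configuration code fits in a block: `⌜c⌝ < 2ᴮ`. [folklore] -/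
theorem cfgCode_lt_two_pow_nB {c : tm.Cfg} (h : Fits (nW tm ℓ a) c) :
    cfgCode tm (nW tm ℓ a) c < 2 ^ nB tm ℓ a := by
  refine (dcode_lt (fields_lt h)).trans_le (Nat.pow_le_pow_right (by norm_num) ?_)
  have hlen : (fields tm c).length = nStk tm + 2 := by simp [fields]
  rw [hlen, Nat.mul_comm]
  exact nStk_mul_nW_le_nB

/-- Reduction modulo `2ᴮ` of a small number is the identity. [folklore] -/
theorem lsp_nS_nB_of_lt {v : ℕ} (hv : v < 2 ^ nB tm ℓ a) : BASICModel.lsp (nS tm ℓ a) v (nB tm ℓ a) = v := by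
  rw [NatModel.lsp_eq, min_eq_left nB_le_size_nS]; exact Nat.mod_eq_of_lt hv

/-- The stacks of an initial configuration are no longer than the input (private copy of
`FinTM2Sim.length_initList_le`, `TM2Circuits.lean`, to keep the imports light). [folklore] -/
private theorem length_stk_initList_le (input : List (tm.Γ tm.k₀)) (k : tm.K) :
    ((initList tm input).stk k).length ≤ input.length := by
  rw [TM2Comp.initList_eq]
  dsimp only
  by_cases hk : k = tm.k₀
  · subst hk; rw [Function.update_self]
  · rw [Function.update_of_ne hk]; exact Nat.zero_le _

/-- Fitting of the configurations of the padded run. [folklore] -/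
theorem fits_run (input : List (tm.Γ tm.k₀)) (hlen : input.length = a.size) {j : ℕ} (hj : j ≤ nL ℓ a) :
    Fits (nW tm ℓ a) ((TM2Sim.stepTotal tm)^[j] (initList tm input)) :=
  fits_iterate labWidth_le_nW stWidth_le_nW symWidth_mul_le_nW
    (fun k => (length_stk_initList_le input k).trans hlen.le) hj

/-- **The blocks of the history are the codes of the configurations of the padded run**
(Krajíček 1995, Lemma 6.1.1: `w` codes the computation). [cite: Krajicek1995, Lemma 6.1.1 (p. 86)] -/
theorem blk_hist_eq_cfgCode (input : List (tm.Γ tm.k₀)) (hlen : input.length = a.size)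
    (hinit : (initG tm ℓ cfalse ctrue lab0 st0 kin).fn ![a] = cfgCode tm (nW tm ℓ a) (initList tm input)) :
    ∀ {j : ℕ}, j ≤ nL ℓ a →
      BASICModel.blk (nS tm ℓ a)
          ((hist (initG tm ℓ cfalse ctrue lab0 st0 kin) (stepG tm ℓ) ℓ (blockTerm tm ℓ)).fn ![a]) j (nB tm ℓ a) =
        cfgCode tm (nW tm ℓ a) ((TM2Sim.stepTotal tm)^[j] (initList tm input))
  | 0, _ => by
    have h0 := blk_hist_zero (ℓ := ℓ) (β := blockTerm tm ℓ)
      (good_initG (tm := tm) (ℓ := ℓ) (cfalse := cfalse) (ctrue := ctrue) (lab0 := lab0) (st0 := st0) (kin := kin))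
      (good_stepG (tm := tm) (ℓ := ℓ)) ![a]
    refine h0.trans ?_
    change BASICModel.lsp (nS tm ℓ a) _ (nB tm ℓ a) = cfgCode tm (nW tm ℓ a) (initList tm input)
    rw [hinit]
    exact lsp_nS_nB_of_lt (by simpa using cfgCode_lt_two_pow_nB (fits_run (ℓ := ℓ) input hlen (Nat.zero_le _)))
  | j + 1, hj => by
    have ih := blk_hist_eq_cfgCode input hlen hinit (Nat.le_of_succ_le hj)
    have hs := blk_hist_succ (ℓ := ℓ) (β := blockTerm tm ℓ)
      (good_initG (tm := tm) (ℓ := ℓ) (cfalse := cfalse) (ctrue := ctrue) (lab0 := lab0) (st0 := st0) (kin := kin))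
      (good_stepG (tm := tm) (ℓ := ℓ)) ![a] (j := j) ((NatModel.lt_model_iff _ _).2 hj)
    refine hs.trans ?_
    change BASICModel.lsp (nS tm ℓ a) ((stepG tm ℓ).fn (Fin.snoc (Fin.snoc ![a] j)
      (BASICModel.blk (nS tm ℓ a) _ j (nB tm ℓ a)))) (nB tm ℓ a) = _
    rw [snoc_snoc_vec, ih, fn_stepG_cfgCode (fits_run input hlen (Nat.le_of_succ_le hj))
      ((TM2Sim.good_initList tm input).iterate tm j),
      lsp_nS_nB_of_lt, Function.iterate_succ_apply']
    rw [← Function.iterate_succ_apply' (f := TM2Sim.stepTotal tm)]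
    exact cfgCode_lt_two_pow_nB (fits_run input hlen hj)

/-- **The value of the iteration**: the code of configuration `L = |ℓ(a)|` of the padded run.
[cite: Krajicek1995, Lemma 6.1.1 (p. 86)] -/
theorem fn_iterate_eq_cfgCode (input : List (tm.Γ tm.k₀)) (hlen : input.length = a.size)
    (hinit : (initG tm ℓ cfalse ctrue lab0 st0 kin).fn ![a] = cfgCode tm (nW tm ℓ a) (initList tm input)) :
    (iterate (initG tm ℓ cfalse ctrue lab0 st0 kin) (stepG tm ℓ) ℓ (blockTerm tm ℓ)).fn ![a] =
      cfgCode tm (nW tm ℓ a) ((TM2Sim.stepTotal tm)^[nL ℓ a] (initList tm input)) := by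
  rw [fn_iterate good_initG good_stepG]
  exact blk_hist_eq_cfgCode input hlen hinit le_rfl

end Run

/-! ## Values in `ℕ` of the output definitions -/

section OutValues

variable {tm : FinTM2} {ℓ : Language.boundedArith.Term (Fin 1)} {a : ℕ} {kout cout : ℕ}

/-- Digit `i` (base `2ᵇ`, exponent clipped at `|S|`) of the output field of a code `c`. [folklore] -/
noncomputable def outDigit (tm : FinTM2) (ℓ : Language.boundedArith.Term (Fin 1)) (a kout c i : ℕ) : ℕ :=
  field (nW tm ℓ a) c (kout + 2) / 2 ^ min (i * symWidth tm) (nS tm ℓ a).size % 2 ^ symWidth tm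

/-- The value of `outSymG`. [folklore] -/
theorem fn_outSymG (hk : kout < nStk tm) (c i : ℕ) :
    (outSymG tm ℓ kout).fn ![a, c, i] = outDigit tm ℓ a kout c i := by
  rw [outSymG, fn_substLast (good_blkG.substArgs _) (good_blkG.substArgs _), fn_substArgs good_blkG, fn_blkG,
    fn_substArgs good_blkG, fn_blkG, snoc_vec3]
  simp only [Matrix.cons_val_zero, Matrix.cons_val_one, Matrix.cons_val, Term.realize_var, realize_natConst,
    Term.realize_relabel, realize_S3, realize_W3]
  have hcs : (![a, c, i, BASICModel.blk (nS tm ℓ a) c (kout + 2) (nW tm ℓ a)] : Fin 4 → ℕ) ∘ Fin.castSucc =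
      ![a, c, i] := by
    funext k; fin_cases k <;> rfl
  rw [hcs, realize_S3, NatModel.blk_eq, NatModel.blk_eq, min_eq_left (mul_nW_le_size_nS (by omega)),
    min_eq_left nW_le_size_nS, min_eq_left (symWidth_le_nW.trans nW_le_size_nS), outDigit, field, Nat.mul_comm]

/-- **The output bit**: `1` if the digit is `cout`, else `0`. [folklore] -/
theorem fn_outDigitG (hk : kout < nStk tm) (c i : ℕ) :
    (outDigitG tm ℓ kout cout).fn ![a, c, i] = if outDigit tm ℓ a kout c i = cout then 1 else 0 := by
  have hc : ∀ p ∈ [(cout, num 3 1)], p.2.Good := by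
    intro p hp
    simp only [List.mem_cons, List.not_mem_nil, or_false] at hp
    rcases hp with rfl; exact good_num _ _
  unfold outDigitG
  split_ifs with h
  · rw [fn_select_of_mem good_outSymG hc (good_num _ _) (by simp) _ (p := (cout, num 3 1)) (by simp)
        (by rw [fn_outSymG hk, h]; exact (fn_num_nat cout _).symm.trans (fn_num cout ![a, c, i]))]
    exact fn_num_nat _ _
  · rw [fn_select_of_not_mem good_outSymG hc (good_num _ _) (by simp) _ (by
        intro p hp
        simp only [List.mem_cons, List.not_mem_nil, or_false] at hp
        subst hp
        rw [fn_outSymG hk, ← fn_num (n := 3) cout ![a, c, i], fn_num_nat]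
        exact h)]
    exact fn_num_nat _ _

/-- **The bits of the output** (`cout ≠ 0`): `outG (a, c) < 2ᵂ` and its bit `i < W` is `1` iff the
`i`-th output digit of `c` is `cout`. [cite: Krajicek1995, §6.1 (p. 86)] -/
theorem outG_spec (hk : kout < nStk tm) (hcout : cout ≠ 0) (c : ℕ) :
    (outG tm ℓ kout cout).fn ![a, c] < 2 ^ nW tm ℓ a ∧
      ∀ i < nW tm ℓ a, ((outG tm ℓ kout cout).fn ![a, c]).testBit i =
        decide (outDigit tm ℓ a kout c i = cout) := by
  rw [outG, if_neg hcout]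
  set y := (collect (outDigitG tm ℓ kout cout) ((widthTerm tm ℓ).relabel ![0]) (natConst 1)).fn ![a, c] with hy
  have hW : mLen (((widthTerm tm ℓ).relabel ![(0 : Fin 2)]).realize ![a, c]) = nW tm ℓ a := by
    rw [Term.realize_relabel, vec2_comp_zero]; rfl
  have hB : seqB (natConst 1 : Language.boundedArith.Term (Fin 2)) ![a, c] = 1 := by
    change Nat.size ((natConst 1 : Language.boundedArith.Term (Fin 2)).realize ![a, c]) = 1
    rw [realize_natConst]; rfl
  have hS : (seqS ((widthTerm tm ℓ).relabel ![(0 : Fin 2)]) (natConst 1) ![a, c]).size = nW tm ℓ a + 2 := by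
    change Nat.size ((sizeT ((widthTerm tm ℓ).relabel ![(0 : Fin 2)]) (natConst 1)).realize ![a, c]) = _
    simp only [sizeT, realize_smash, realize_succ, realize_mul, realize_natConst, Nat.size_pow,
      size_two_mul_succ, Term.realize_relabel, vec2_comp_zero]
    change (nW tm ℓ a + 1) * Nat.size 1 + 1 = _
    simp
  have h1 := msp_collect (ℓ := (widthTerm tm ℓ).relabel ![(0 : Fin 2)]) (β := natConst 1)
    (good_outDigitG (tm := tm) (ℓ := ℓ) (kout := kout) (cout := cout)) ![a, c]
  rw [hW, hB, hMul_model, NatModel.msp_eq, hS, Nat.mul_one, min_eq_left (by omega)] at h1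
  change y / 2 ^ nW tm ℓ a = 0 at h1
  refine ⟨Nat.lt_of_div_eq_zero (Nat.two_pow_pos _) h1, fun i hi => ?_⟩
  have h2 := blk_collect (ℓ := (widthTerm tm ℓ).relabel ![(0 : Fin 2)]) (β := natConst 1)
    (good_outDigitG (tm := tm) (ℓ := ℓ) (kout := kout) (cout := cout)) ![a, c] (i := i)
    ((NatModel.lt_model_iff _ _).2 (by rw [hW]; exact hi))
  rw [hB, NatModel.blk_eq, NatModel.lsp_eq, hS, Nat.mul_one, min_eq_left (by omega), min_eq_left (by omega),
    pow_one, snoc_vec2, fn_outDigitG hk] at h2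
  change y / 2 ^ i % 2 = _ at h2
  rw [Nat.testBit_eq_decide_div_mod_eq, h2]
  by_cases h : outDigit tm ℓ a kout c i = cout <;> simp [h]

/-- **The output digits of the code of a halting configuration** are the codes of the output
symbols (`0` beyond the output). [folklore] -/
theorem outDigit_cfgCode_eq {c : tm.Cfg} (hfit : Fits (nW tm ℓ a) c) (i : ℕ) :
    outDigit tm ℓ a (idxOf tm tm.k₁) (cfgCode tm (nW tm ℓ a) c) i =
      ((c.stk tm.k₁).map (symCode tm tm.k₁)).getD i 0 := by
  have hsym : ∀ x ∈ (c.stk tm.k₁).map (symCode tm tm.k₁), x < 2 ^ symWidth tm := fun x hx => by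
    obtain ⟨γ, -, rfl⟩ := List.mem_map.1 hx; exact symCode_lt _ _
  have hf : field (nW tm ℓ a) (cfgCode tm (nW tm ℓ a) c) (idxOf tm tm.k₁ + 2) = stkCode tm (c.stk tm.k₁) := by
    have := field_cfgCode_stk hfit (idxOf tm tm.k₁)
    rwa [stkOf_idxOf] at this
  rw [outDigit, hf]
  by_cases hi : i * symWidth tm ≤ (nS tm ℓ a).size
  · rw [min_eq_left hi, stkCode, Nat.mul_comm, dcode_digit hsym]
  · rw [min_eq_right (not_le.1 hi).le]
    have hlt : stkCode tm (c.stk tm.k₁) < 2 ^ (nS tm ℓ a).size :=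
      (stkCode_lt _).trans_le (Nat.pow_le_pow_right (by norm_num)
        (((Nat.mul_le_mul_left _ (Nat.le_add_right _ _)).trans (hfit.2.2 _)).trans nW_le_size_nS))
    rw [Nat.div_eq_of_lt hlt, Nat.zero_mod, List.getD_eq_default]
    rw [List.length_map]
    -- `i` is beyond the stack: `|stk|·b ≤ W ≤ |S| < i·b`
    have h1 : symWidth tm * (c.stk tm.k₁).length ≤ (nS tm ℓ a).size :=
      ((Nat.mul_le_mul_left _ (Nat.le_add_right _ _)).trans (hfit.2.2 _)).trans nW_le_size_nS
    by_contra hlen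
    rw [not_le] at hlen
    exact hi ((Nat.mul_le_mul_right _ hlen.le).trans (by rw [Nat.mul_comm]; exact h1))

/-- **Decoding the output**: for the code of a good fitting configuration whose output stack is
`(encodeNat m).map eout.symm`, `outG` returns `m` (case `cout ≠ 0`). [cite: Krajicek1995, §6.1 (p. 86)] -/
theorem fn_outG_cfgCode (eout : tm.Γ tm.k₁ ≃ Bool) {c : tm.Cfg} (hfit : Fits (nW tm ℓ a) c)
    (hgood : TM2Sim.Good tm c) {m : ℕ} (hout : c.stk tm.k₁ = (encodeNat m).map eout.symm)
    (hcout : symCode tm tm.k₁ (eout.symm true) ≠ 0) :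
    (outG tm ℓ (idxOf tm tm.k₁) (symCode tm tm.k₁ (eout.symm true))).fn ![a, cfgCode tm (nW tm ℓ a) c] = m := by
  have hb : 1 ≤ symWidth tm := by
    have := symCode_lt (tm := tm) tm.k₁ (eout.symm true)
    by_contra h
    rw [not_le, Nat.lt_one_iff] at h
    rw [h, pow_zero] at this
    omega
  obtain ⟨hlt, hbits⟩ := outG_spec (ℓ := ℓ) (a := a) (idxOf tm tm.k₁).isLt hcout (cfgCode tm (nW tm ℓ a) c)
  -- the output has at most `W` symbols
  have hlenW : (encodeNat m).length ≤ nW tm ℓ a := by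
    have h1 : symWidth tm * (c.stk tm.k₁).length ≤ nW tm ℓ a :=
      (Nat.mul_le_mul_left _ (Nat.le_add_right _ _)).trans (hfit.2.2 _)
    rw [hout, List.length_map] at h1
    exact le_trans (Nat.le_mul_of_pos_left _ hb) h1
  refine Nat.eq_of_testBit_eq fun i => ?_
  by_cases hi : i < nW tm ℓ a
  · rw [hbits i hi, outDigit_cfgCode_eq hfit, hout, List.map_map, ← getD_encodeNat']
    -- digit `i` is `cout` iff bit `i` is `true`
    rw [List.getD_eq_getElem?_getD, List.getD_eq_getElem?_getD, List.getElem?_map]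
    cases hmi : (encodeNat m)[i]? with
    | none => simp [hcout.symm]
    | some bt =>
      simp only [Option.map_some, Option.getD_some, Function.comp_apply]
      cases bt
      · -- a `false` symbol never has the code of the `true` symbol
        rw [decide_eq_false]
        intro h
        have hsymF : TM2Sim.IsSym tm tm.k₁ (eout.symm false) := by
          refine hgood tm.k₁ _ ?_
          rw [hout]; exact List.mem_map.2 ⟨false, List.mem_of_getElem? hmi, rfl⟩
        by_cases hsymT : TM2Sim.IsSym tm tm.k₁ (eout.symm true)
        · exact absurd (eout.symm.injective (symCode_injOn tm.k₁ hsymF hsymT h)) (by decide)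
        · exact absurd (symCode_pos hsymF) (by rw [h, symCode, dif_neg (mt (mem_symSet tm).1 hsymT)]; decide)
      · simp
  · rw [Nat.testBit_eq_false_of_lt (hlt.trans_le (Nat.pow_le_pow_right (by norm_num) (not_lt.1 hi))),
      Nat.testBit_eq_false_of_lt]
    calc m < 2 ^ (encodeNat m).length := by rw [length_encodeNat']; exact Nat.lt_size_self m
      _ ≤ 2 ^ i := Nat.pow_le_pow_right (by norm_num) (hlenW.trans (not_lt.1 hi))

/-- **Decoding the output, degenerate case**: if the output symbol `true` cannot occur
(`cout = 0`) then every output is `0`, and so is `outG`. [folklore] -/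
theorem fn_outG_cfgCode_zero (eout : tm.Γ tm.k₁ ≃ Bool) {c : tm.Cfg} (hgood : TM2Sim.Good tm c) {m : ℕ}
    (hout : c.stk tm.k₁ = (encodeNat m).map eout.symm) (hcout : symCode tm tm.k₁ (eout.symm true) = 0) (u : ℕ) :
    (outG tm ℓ (idxOf tm tm.k₁) (symCode tm tm.k₁ (eout.symm true))).fn ![a, u] = m := by
  rw [outG, if_pos hcout, fn_num_nat]
  symm
  refine eq_zero_of_true_not_mem_encodeNat fun hmem => ?_
  have hsym : TM2Sim.IsSym tm tm.k₁ (eout.symm true) := by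
    refine hgood tm.k₁ _ ?_
    rw [hout]; exact List.mem_map.2 ⟨true, hmem, rfl⟩
  exact absurd hcout (symCode_pos hsym).ne'

end OutValues

/-! ## The value of `machineG` and the discharge -/

section Final

variable {tm : FinTM2} {a : ℕ}

/-- Semantics of the totality sentence in any structure. [folklore] -/
theorem realize_totalitySentence_iff (M : Type) [Language.boundedArith.Structure M]
    (φ : Language.boundedArith.Formula (Fin 2)) :
    (M ⊨ totalitySentence φ) ↔ ∀ x : M, ∃ y : M, φ.Realize ![x, y] := by
  simp only [totalitySentence, Sentence.Realize, Formula.Realize, BoundedFormula.realize_all,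
    BoundedFormula.realize_ex, BoundedFormula.realize_relabel, Nat.add_zero, Fin.castAdd_zero,
    Fin.cast_refl, Function.comp_id, Sum.elim_comp_inr]
  refine forall_congr' fun x => exists_congr fun y => ?_
  congr! 1
  ext i; fin_cases i <;> rfl

/-- Semantics of the uniqueness sentence in any structure. [folklore] -/
theorem realize_uniquenessSentence_iff (M : Type) [Language.boundedArith.Structure M]
    (φ : Language.boundedArith.Formula (Fin 2)) :
    (M ⊨ uniquenessSentence φ) ↔ ∀ x y y' : M, φ.Realize ![x, y] → φ.Realize ![x, y'] → y = y' := by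
  simp only [uniquenessSentence, Sentence.Realize, Formula.Realize, BoundedFormula.realize_all,
    BoundedFormula.realize_imp, BoundedFormula.realize_relabel, Nat.add_zero, Fin.castAdd_zero,
    Fin.cast_refl, Function.comp_id, BoundedFormula.realize_bdEqual]
  refine forall_congr' fun x => forall_congr' fun y => forall_congr' fun y' =>
    imp_congr ?_ (imp_congr ?_ Iff.rfl)
  · congr! 1
    ext i; fin_cases i <;> rfl
  · congr! 1
    ext i; fin_cases i <;> rfl

/-- The graph of a definition, as a formula in the two free variables `x, y`. [folklore] -/
theorem realize_graph_toFormula {M : Type} [Language.boundedArith.Structure M] (G : GDef 1) (x y : M) :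
    G.graph.toFormula.Realize ![x, y] ↔ G.Rel ![x] y := by
  rw [SForm.realize_toFormula, GDef.Rel]
  have : (Fin.snoc ![x] y : Fin 2 → M) = ![x, y] := by funext k; fin_cases k <;> rfl
  rw [this]

/-- **A good definition `Σᵇ₁`-defines its standard value in `S₂¹`**: the graph formula is `Σᵇ₁`,
holds of `(a, G(a))` in `ℕ`, and `S₂¹ ⊨ᵇ` totality and uniqueness (Buss 1986, Ch. 2:
`Σᵇ₁`-definability). [cite: Buss1986, §2.2] -/
theorem isSigmabDefinable_of_good {G : GDef 1} (hG : G.Good) {f : ℕ → ℕ} (hf : ∀ a, G.fn ![a] = f a) :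
    IsSigmabDefinable (S2 1) 1 f := by
  refine ⟨G.graph.toFormula, SForm.isSigmab_toFormula hG.sig, fun a => ?_, ?_, ?_⟩
  · rw [realize_graph_toFormula, ← hf]
    exact (hG.isFn ℕ).rel_fn _
  · refine Theory.models_sentence_iff.2 fun M => ?_
    haveI : (M : Type) ⊨ BASIC := (Theory.model_union_iff.1 M.is_model).1
    haveI : (M : Type) ⊨ PINDScheme (sigmabFormulas 1) := (Theory.model_union_iff.1 M.is_model).2
    rw [realize_totalitySentence_iff]
    intro x
    obtain ⟨y, hy⟩ := (hG.isFn M).total ![x]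
    exact ⟨y, (realize_graph_toFormula G x y).2 hy⟩
  · refine Theory.models_sentence_iff.2 fun M => ?_
    haveI : (M : Type) ⊨ BASIC := (Theory.model_union_iff.1 M.is_model).1
    haveI : (M : Type) ⊨ PINDScheme (sigmabFormulas 1) := (Theory.model_union_iff.1 M.is_model).2
    rw [realize_uniquenessSentence_iff]
    intro x y y' hy hy'
    exact (hG.isFn M).unique ![x] y y' ((realize_graph_toFormula G x y).1 hy) ((realize_graph_toFormula G x y').1 hy')

/-- **The value of `machineG` in `ℕ` is the function computed by the machine** (Krajíček 1995,
Lemma 6.1.1; Buss 1986, Ch. 3). [cite: Krajicek1995, Lemma 6.1.1 (p. 86)] -/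
theorem fn_machineG (A : TM2ComputableAux Bool Bool) {f : ℕ → ℕ} {p : Polynomial ℕ}
    (hA : ∀ a, A.OutputsWithin (encodeNat a) (encodeNat (f a)) (p.eval (encodeNat a).length)) (a : ℕ) :
    (machineG A.tm (timeTerm p) (symCode A.tm A.tm.k₀ (A.inputAlphabet.symm false))
        (symCode A.tm A.tm.k₀ (A.inputAlphabet.symm true)) (labCode A.tm (some A.tm.main))
        (stCode A.tm A.tm.initialState) (idxOf A.tm A.tm.k₀) (idxOf A.tm A.tm.k₁)
        (symCode A.tm A.tm.k₁ (A.outputAlphabet.symm true))).fn ![a] = f a := by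
  set tm := A.tm
  set ℓ := timeTerm p
  set input : List (tm.Γ tm.k₀) := (encodeNat a).map A.inputAlphabet.symm with hinput
  have hlen : input.length = a.size := by rw [hinput, List.length_map, length_encodeNat']
  have hb : 1 ≤ symWidth tm := one_le_symWidth (A.inputAlphabet.symm true)
  -- the run, padded to `L = |ℓ(a)| > p(|a|)` steps, ends in the halting configuration
  have hrun : (TM2Sim.stepTotal tm)^[nL ℓ a] (initList tm input) =
      haltList tm ((encodeNat (f a)).map A.outputAlphabet.symm) :=
    TM2Sim.iterate_stepTotal_of_outputsWithin A ((hA a).mono (by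
      rw [length_encodeNat']; exact (eval_lt_size_timeTerm p a).le))
  -- the initial code
  have hinit : (initG tm ℓ (symCode tm tm.k₀ (A.inputAlphabet.symm false))
      (symCode tm tm.k₀ (A.inputAlphabet.symm true)) (labCode tm (some tm.main)) (stCode tm tm.initialState)
      (idxOf tm tm.k₀)).fn ![a] = cfgCode tm (nW tm ℓ a) (initList tm input) := by
    rw [fn_initG (idxOf tm tm.k₀).isLt, fn_inputStackG hb (symCode_lt _ _) (symCode_lt _ _),
      cfgCode_initList, hinput, stkCode_input]
  rw [machineG, fn_substLast good_outG (good_iterate good_initG good_stepG),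
    fn_iterate_eq_cfgCode input hlen hinit, hrun, snoc_vec]
  have hfit : Fits (nW tm ℓ a) (haltList tm ((encodeNat (f a)).map A.outputAlphabet.symm)) := by
    rw [← hrun]; exact fits_run input hlen le_rfl
  have hgood : TM2Sim.Good tm (haltList tm ((encodeNat (f a)).map A.outputAlphabet.symm)) := by
    rw [← hrun]; exact (TM2Sim.good_initList tm input).iterate tm _
  have hout : (haltList tm ((encodeNat (f a)).map A.outputAlphabet.symm)).stk tm.k₁ =
      (encodeNat (f a)).map A.outputAlphabet.symm := by
    rw [TM2Comp.haltList_eq]; dsimp only; rw [Function.update_self]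
  by_cases hcout : symCode tm tm.k₁ (A.outputAlphabet.symm true) = 0
  · exact fn_outG_cfgCode_zero A.outputAlphabet hgood hout hcout _
  · exact fn_outG_cfgCode A.outputAlphabet hfit hgood hout hcout

end Final

end S2Machine

/-- **Discharge of `isSigmabDefinable_S2_one_of_polyTimeComputable`: every polynomial-time
computable `f : ℕ → ℕ` is `Σᵇ₁`-definable in `S₂¹`** (Buss 1986, Ch. 3 / Ch. 5, Main Theorem,
easy direction; Krajíček 1995, §6.1, Lemma 6.1.1).  The defining formula is the graph of the
uniform `Σᵇ₁` definition `S2Machine.machineG` of the padded computation of a `TM2` machine for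
`f`; it is total and functional in every model of `S₂¹ = BASIC + Σᵇ₁-PIND` (`good_machineG`,
resting on the in-theory bootstrapping `BoundedArithS2*.lean`), and its value in `ℕ` is `f`
(`S2Machine.fn_machineG`). [cite: Buss1986, Ch. 5  Main Theorem  easy direction: "ev] -/
theorem isSigmabDefinable_S2_one_of_polyTimeComputable_holds :
    isSigmabDefinable_S2_one_of_polyTimeComputable := by
  intro f hf
  obtain ⟨p, A, hA⟩ := hf
  exact S2Machine.isSigmabDefinable_of_good (S2Machine.good_machineG _ _ _ _ _ _ _ _ _)
    (S2Machine.fn_machineG A hA)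

-- keep the namespace balanced for the closing `end` below
namespace S2Machine

end S2Machine

end Literature.Computability.Complexity
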